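import Summits.ABC.IUTFork.Joshi.BundlingRings
import Summits.ABC.IUTFork.Joshi.LocalPeriodRingsSection
import HarnessLib

/-!
# Joshi's prime bundling rings (ATS III §7.5) over slot T-09's period rings: Lemma 7.5.1.9's input «`B_{E′_w}` is a finite
# `B_p`-module» PROVED and (7.5.2.2)'s input «`B_{E′_w} ↪ B_p ⊗_{ℚ_p} E′_w`» DERIVED from Lemma 5.2.3.1 — proof/bridge file

Block E (rung LADDER-ABC:A2.E) of the abc-iut cell; seat abc-iut-E-t13 (slot T-13, gen 6). PROOF/BRIDGE companion of the seat's own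
SIGNATURE file `Joshi/BundlingRings.lean` (p429549: `ATS3.PrimeBundlingDatum`, its NAMED HYPOTHESES `FactorsFiniteOverBp` — the
per-factor input of [J-III] Lemma 7.5.1.9 — and `ToTensEInjective` — the [FF18] input of (7.5.2.2) —, and the DERIVED
`bundleAll_finite_of_factors` / `bundleOddToTensE_injective`) and of `Joshi/LocalPeriodRingsSection.lean` (this seat: the section
`secBELinear : B_E →ₗ[ℚ_p] B ⊗_{ℚ_p} E` of the multiplication map, injective, from Lemma 5.2.3.1), over slot T-09's typed §5.2
carriers (`Joshi/LocalPeriodRings.lean`, p429989: `PeriodRingTower` — the ring `B = B_p` with `B ↪ B_dR = Ω` —, `BEDatum` — a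
`p`-adic field `E ⊂ Ω` with `E_0 ≤ E` —, `BE E = B ⊔ E ⊂ Ω` = Joshi's `B_E`, `Btilde = B ⊗_{ℚ_p} E`). Source: K. Joshi,
*Construction of Arithmetic Teichmüller Spaces III*, arXiv:2401.13508**v4** = [J-III] (UNREFEREED; bib `Joshi2024ATS3`; disputed by
`Mochizuki2024JoshiReport`); locators «p.N l.a–b» = PDF page/lines of the cell's render `HOME/lit/renders/Joshi-arxiv-2401.13508/`.
DEFS-FREEZE respected (p429549 / p429989 imported, nothing re-declared); no `def … : Prop`, no new `Prop` fact, no instance (the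
`B`-algebra structure on `B_E` is a DEFINITION `algebraBE`, bound with `letI`, as in E-t11's `algebraThroughE`), no notation, no
axiom, 0 `sorry`. TAKES NO SIDE on [IUTchIII] Cor. 3.12, on Joshi's claims or on Mochizuki's report on them; typed ≠ proved ≠ endorsed.

## What is proved (MERGE-DEBT `Bp`, `BE w` of p429549's INTERIM CARRIER RULE, paid against T-09)

* `PeriodRingTower.toBE` / `algebraBE`: `B → B_E` ((5.2.4.1)–(5.2.4.2), `B ⊂ B_E ⊂ B_dR`) and the resulting `B`-algebra structure
  on `B_E` (a `def`, not an instance).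
* **J3:Lem7.5.1.9, per-factor input, PROVED at the T-09 carriers — unconditionally** (p.58 l.70–77 «`B_{E′_w} = B_p ⊗_{E′_{w,0}} E′_w`
  … is a finite module over `B_p`»): `BEDatum.finite_BE : Module.Finite B B_E` — `B_E` is the image of the finite free `B`-module
  `B̃_E = B ⊗_{ℚ_p} E` (E-t58's `btilde_finite`, (5.2.5.4) last clause) under the `B`-linear multiplication map `btildeToBE`. Hence
  for EVERY bundling datum on these carriers `FactorsFiniteOverBp` HOLDS (`factorsFiniteOverBp_periodRings`) and Lemma 7.5.1.9
  «`B̆_{L′,p}` is a finite module over `B_p`» follows by p429549's `bundleAll_finite_of_factors` (`bundleAll_finite_periodRings`).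
* **J3:(7.5.2.2) input DERIVED at the T-09 carriers from Lemma 5.2.3.1** (p.59 l.28–41 «using the fact that `B_E ↪ B ⊗_{ℚ_p} E`»):
  for every bundling datum on these carriers whose comparison maps `toTensE w` ARE the sections `secBELinear` (over
  `w ∈ 𝕍^{odd,ss}_p`), `ToTensEInjective` HOLDS (`toTensEInjective_of_secBELinear`), hence `(⊕_w B_{E′_w})^{ℓ⋇} ↪ B̑_p^{ℓ⋇}`
  (`bundleOddToTensE_injective_of_secBELinear`). The remaining trust base is exactly Lemma 5.2.3.1 (`BELinDisjoint`, cited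
  [FF18, Prop. 1.6.9]) at each `w ∈ 𝕍^{odd,ss}_p` — no (5.2.5.4) witness (cf. p433275's `toBtilOfSplits`).
* NON-VACUITY: `ofPeriodRings` builds such a datum from T-09 data and the remaining §7.5/§7.7 inputs (norms, loci, `⊗`, `q`-roots),
  and `toTensEInjective_ofPeriodRings` / `factorsFiniteOverBp_ofPeriodRings` record both discharges for it.

bears_on: LADDER-ABC:A2.E. [claim: Joshi2024ATS3, status: disputed]
-/

noncomputable section

open scoped TensorProduct

namespace Summit.ABC.IUTFork.Joshi.ATS3

namespace PeriodRingTower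

variable {F B E0 : Type} [Field F] [CommRing B] [Field E0] {Y : Type} {K : Y → Type} [∀ y, Field (K y)]
  {G : Type} [Group G] {D : PeriodRingDatum F B E0 Y K G} {p : ℕ} [Fact p.Prime] [Algebra ℚ_[p] B]
  {Ω : Type} [Field Ω] [Algebra ℚ_[p] Ω] (T : PeriodRingTower D p Ω)

/-! ## 1. `B → B_E` and the `B`-algebra structure on `B_E` -/

/-- **`B → B_E`** ((5.2.4.1)–(5.2.4.2) p.39 l.47–49: `B ⊂ B_E = B ⊗_{E_0} E ⊂ B_dR`): the embedding `toBdR` with its range cut down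
to `B_E`. [folklore] -/
def toBE (E : IntermediateField ℚ_[p] Ω) : B →ₐ[ℚ_[p]] T.BE E :=
  AlgHom.codRestrict T.toBdR (T.BE E) (T.toBdR_mem_BE E)

/-- Underlying period of `toBE b` is `toBdR b`. [folklore] -/
@[simp] theorem coe_toBE (E : IntermediateField ℚ_[p] Ω) (b : B) : ((T.toBE E b : T.BE E) : Ω) = T.toBdR b := rfl

/-- `B → B_E` is injective. [folklore] -/
theorem toBE_injective (E : IntermediateField ℚ_[p] Ω) : Function.Injective (T.toBE E) := fun x y hxy =>
  T.toBdR_injective (by rw [← T.coe_toBE E x, ← T.coe_toBE E y, hxy])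

/-- **`B_E` as a `B`-algebra** (p.58 l.70–77 «a finite module over `B_p`»; §5.2.1) — through `B → B_E`. A DEFINITION (bind with
`letI`), not an instance (typer lint). [folklore] -/
abbrev algebraBE (E : IntermediateField ℚ_[p] Ω) : Algebra B (T.BE E) := (T.toBE E).toRingHom.toAlgebra

/-- With `algebraBE`: `b • x = toBdR(b)·x` in `B_dR`. [folklore] -/
theorem coe_smul_BE (E : IntermediateField ℚ_[p] Ω) (b : B) (x : T.BE E) :
    letI := T.algebraBE E
    ((b • x : T.BE E) : Ω) = T.toBdR b * (x : Ω) := rfl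

namespace BEDatum

variable {T} (ℰ : T.BEDatum)

/-! ## 2. Lemma 7.5.1.9's input: `B_E` is a finite `B`-module (unconditionally) -/

/-- The multiplication map `m : B̃_E = B ⊗_{ℚ_p} E → B_E` as a **`B`-linear** map onto `B_E` (`B` acting on the left factor of
`B̃_E` and through `B → B_E` on `B_E`). [folklore] -/
def btildeToBE : letI := T.algebraBE ℰ.E; ℰ.Btilde →ₗ[B] T.BE ℰ.E :=
  letI := T.algebraBE ℰ.E
  { toFun := fun z => ⟨ℰ.btildeToBdR z, by rw [← ℰ.btildeToBdR_range]; exact ⟨z, rfl⟩⟩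
    map_add' := fun x y => Subtype.ext (by simp only [map_add]; rfl)
    map_smul' := fun b z => Subtype.ext (by
      change ℰ.btildeToBdR (b • z) = T.toBdR b * ℰ.btildeToBdR z
      induction z using TensorProduct.induction_on with
      | zero => rw [smul_zero, map_zero, mul_zero]
      | tmul b' e =>
          rw [TensorProduct.smul_tmul', smul_eq_mul, BEDatum.btildeToBdR, Algebra.TensorProduct.productMap_apply_tmul,
            Algebra.TensorProduct.productMap_apply_tmul, map_mul, mul_assoc]
      | add x y hx hy => rw [smul_add, map_add, hx, hy, map_add, mul_add]) }

/-- Underlying period of `btildeToBE z` is `m z`. [folklore] -/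
@[simp] theorem coe_btildeToBE (z : ℰ.Btilde) :
    letI := T.algebraBE ℰ.E
    ((ℰ.btildeToBE z : T.BE ℰ.E) : Ω) = ℰ.btildeToBdR z := rfl

/-- `m : B̃_E → B_E` is surjective (`range m = B_E`, p429989). [folklore] -/
theorem btildeToBE_surjective :
    letI := T.algebraBE ℰ.E
    Function.Surjective ℰ.btildeToBE := fun x => by
  obtain ⟨z, hz⟩ := ℰ.exists_btildeToBdR_eq x
  exact ⟨z, Subtype.ext hz⟩

/-- **J3:Lem7.5.1.9's per-factor input PROVED at the T-09 carriers** (p.58 l.70–77 «`B_{E′_w}` … is a finite module over `B_p`»):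
`B_E` is a finitely generated `B`-module — a quotient of the finite free `B`-module `B̃_E = B ⊗_{ℚ_p} E` (E-t58's `btilde_finite`).
No hypothesis. [folklore] -/
theorem finite_BE :
    letI := T.algebraBE ℰ.E
    Module.Finite B (T.BE ℰ.E) := by
  letI := T.algebraBE ℰ.E
  haveI := ℰ.btilde_finite
  exact Module.Finite.of_surjective ℰ.btildeToBE ℰ.btildeToBE_surjective

/-- `secBE` is a section of `btildeToBE` too (same statement inside `B_E`). [folklore] -/
theorem btildeToBE_secBE (x : T.BE ℰ.E) :
    letI := T.algebraBE ℰ.E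
    ℰ.btildeToBE (ℰ.secBE x) = x :=
  Subtype.ext (ℰ.btildeToBdR_secBE x)

end BEDatum

end PeriodRingTower

/-! ## 3. Slot T-13's named hypotheses over the T-09 carriers -/

namespace PrimeBundlingDatum

variable {F B E0 : Type} [Field F] [CommRing B] [Field E0] {Y : Type} {K : Y → Type} [∀ y, Field (K y)]
  {G : Type} [Group G] {Dp : PeriodRingDatum F B E0 Y K G} {p : ℕ} [Fact p.Prime] [Algebra ℚ_[p] B]
  {Ω : Type} [Field Ω] [Algebra ℚ_[p] Ω] {T : PeriodRingTower Dp p Ω}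
  {lstar : ℕ} {I : Type} [Fintype I] [DecidableEq I] (ℰ : I → T.BEDatum) {Tr : Type} [CommRing Tr]

/-- **J3:Lem7.5.1.9's input `FactorsFiniteOverBp` HOLDS for every prime bundling datum on the T-09 carriers** `B_p := B`,
`E′_w := (ℰ w).E`, `B_{E′_w} := B ⊔ E′_w ⊂ B_dR` — by `finite_BE`, unconditionally. FQ type. [claim: Joshi2024ATS3, status: disputed] -/
theorem factorsFiniteOverBp_periodRings
    (D : letI := fun w => T.algebraBE (ℰ w).E
      PrimeBundlingDatum lstar ℚ_[p] B I (fun w => (ℰ w).E) (fun w => T.BE (ℰ w).E) Tr) :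
    letI := fun w => T.algebraBE (ℰ w).E
    Summit.ABC.IUTFork.Joshi.ATS3.PrimeBundlingDatum.FactorsFiniteOverBp D :=
  fun w => (ℰ w).finite_BE

/-- Hence **Lemma 7.5.1.9** «for each `p`, `B̆_{L′,p}` is a finite module over `B_p`» HOLDS at the T-09 carriers (p429549's
derivation fed with the proved input). [claim: Joshi2024ATS3, status: disputed] -/
theorem bundleAll_finite_periodRings
    (D : letI := fun w => T.algebraBE (ℰ w).E
      PrimeBundlingDatum lstar ℚ_[p] B I (fun w => (ℰ w).E) (fun w => T.BE (ℰ w).E) Tr) :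
    letI := fun w => T.algebraBE (ℰ w).E
    Module.Finite B D.BundleAll := by
  letI := fun w => T.algebraBE (ℰ w).E
  exact D.bundleAll_finite_of_factors (factorsFiniteOverBp_periodRings ℰ D)

/-- **J3:(7.5.2.2)'s input `ToTensEInjective` HOLDS — DERIVED from Lemma 5.2.3.1 —** for every prime bundling datum on the T-09
carriers whose comparison maps `B_{E′_w} → B_p ⊗_{ℚ_p} E′_w`, `w ∈ 𝕍^{odd,ss}_p`, are the canonical sections `secBELinear` of
`Joshi/LocalPeriodRingsSection.lean` (available under Lemma 5.2.3.1 `BELinDisjoint`, taken at every `w`). FQ type. [claim: Joshi2024ATS3, status: disputed] -/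
theorem toTensEInjective_of_secBELinear
    (D : letI := fun w => T.algebraBE (ℰ w).E
      PrimeBundlingDatum lstar ℚ_[p] B I (fun w => (ℰ w).E) (fun w => T.BE (ℰ w).E) Tr)
    (h : ∀ w, (ℰ w).BELinDisjoint)
    (hD : letI := fun w => T.algebraBE (ℰ w).E
      ∀ w ∈ D.Vss, D.toTensE w = (ℰ w).secBELinear (h w)) :
    letI := fun w => T.algebraBE (ℰ w).E
    Summit.ABC.IUTFork.Joshi.ATS3.PrimeBundlingDatum.ToTensEInjective D := by
  letI := fun w => T.algebraBE (ℰ w).E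
  intro w hw
  rw [hD w hw]
  exact (ℰ w).secBELinear_injective (h w)

/-- Hence **(7.5.2.2)** «`(⊕_{w∈𝕍^{odd,ss}_p} B_{E′_w})^{ℓ⋇} ↪ B̑_p^{ℓ⋇}`» HOLDS for such data (p429549's
`bundleOddToTensE_injective` fed with the derived input). [claim: Joshi2024ATS3, status: disputed] -/
theorem bundleOddToTensE_injective_of_secBELinear
    (D : letI := fun w => T.algebraBE (ℰ w).E
      PrimeBundlingDatum lstar ℚ_[p] B I (fun w => (ℰ w).E) (fun w => T.BE (ℰ w).E) Tr)
    (h : ∀ w, (ℰ w).BELinDisjoint)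
    (hD : letI := fun w => T.algebraBE (ℰ w).E
      ∀ w ∈ D.Vss, D.toTensE w = (ℰ w).secBELinear (h w)) :
    letI := fun w => T.algebraBE (ℰ w).E
    Function.Injective D.bundleOddToTensE := by
  letI := fun w => T.algebraBE (ℰ w).E
  exact D.bundleOddToTensE_injective (toTensEInjective_of_secBELinear ℰ D h hD)

/-! ## 4. Non-vacuity: a prime bundling datum built on the T-09 carriers -/

/-- **`ofPeriodRings` — a prime bundling datum ON the T-09 carriers**: `ℚ_p`, `B_p := B`, `E′_w := (ℰ w).E`,
`B_{E′_w} := B ⊔ E′_w ⊂ B_dR`, comparison maps `:=` the sections `secBELinear` (under Lemma 5.2.3.1 at every `w`); the other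
§7.5/§7.7 inputs (places, Fréchet norms, loci, `⊗`, tensor norms, `q`-roots) are passed through. [claim: Joshi2024ATS3, status: disputed] -/
def ofPeriodRings (h : ∀ w, (ℰ w).BELinDisjoint) (Vp Vss : Finset I) (hV : Vss ⊆ Vp)
    (nrm : (w : I) → ℝ → T.BE (ℰ w).E → ℝ) (nrm_nonneg : ∀ w ρ x, 0 ≤ nrm w ρ x)
    (locusBE : (w : I) → Set (Fin lstar → T.BE (ℰ w).E)) (tprod : ((w : Vss) → T.BE (ℰ w.1).E) →* Tr)
    (normT : ℝ → Tr → ℝ) (normT_nonneg : ∀ ρ t, 0 ≤ normT ρ t) (qRoot : I → ℝ) (qRoot_pos : ∀ w ∈ Vss, 0 < qRoot w) :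
    letI := fun w => T.algebraBE (ℰ w).E
    PrimeBundlingDatum lstar ℚ_[p] B I (fun w => (ℰ w).E) (fun w => T.BE (ℰ w).E) Tr :=
  letI := fun w => T.algebraBE (ℰ w).E
  { Vp := Vp
    Vss := Vss
    Vss_subset := hV
    nrm := nrm
    nrm_nonneg := nrm_nonneg
    toTensE := fun w => (ℰ w).secBELinear (h w)
    locusBE := locusBE
    tprod := tprod
    normT := normT
    normT_nonneg := normT_nonneg
    qRoot := qRoot
    qRoot_pos := qRoot_pos }

/-- **(7.5.2.2)'s input HOLDS for `ofPeriodRings`** (from Lemma 5.2.3.1). FQ type. [claim: Joshi2024ATS3, status: disputed] -/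
theorem toTensEInjective_ofPeriodRings (h : ∀ w, (ℰ w).BELinDisjoint) (Vp Vss : Finset I) (hV : Vss ⊆ Vp)
    (nrm : (w : I) → ℝ → T.BE (ℰ w).E → ℝ) (nrm_nonneg : ∀ w ρ x, 0 ≤ nrm w ρ x)
    (locusBE : (w : I) → Set (Fin lstar → T.BE (ℰ w).E)) (tprod : ((w : Vss) → T.BE (ℰ w.1).E) →* Tr)
    (normT : ℝ → Tr → ℝ) (normT_nonneg : ∀ ρ t, 0 ≤ normT ρ t) (qRoot : I → ℝ) (qRoot_pos : ∀ w ∈ Vss, 0 < qRoot w) :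
    letI := fun w => T.algebraBE (ℰ w).E
    Summit.ABC.IUTFork.Joshi.ATS3.PrimeBundlingDatum.ToTensEInjective
      (ofPeriodRings ℰ h Vp Vss hV nrm nrm_nonneg locusBE tprod normT normT_nonneg qRoot qRoot_pos) := by
  letI := fun w => T.algebraBE (ℰ w).E
  exact toTensEInjective_of_secBELinear ℰ _ h (fun _ _ => rfl)

/-- **Lemma 7.5.1.9's input HOLDS for `ofPeriodRings`** (unconditionally). FQ type. [claim: Joshi2024ATS3, status: disputed] -/
theorem factorsFiniteOverBp_ofPeriodRings (h : ∀ w, (ℰ w).BELinDisjoint) (Vp Vss : Finset I) (hV : Vss ⊆ Vp)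
    (nrm : (w : I) → ℝ → T.BE (ℰ w).E → ℝ) (nrm_nonneg : ∀ w ρ x, 0 ≤ nrm w ρ x)
    (locusBE : (w : I) → Set (Fin lstar → T.BE (ℰ w).E)) (tprod : ((w : Vss) → T.BE (ℰ w.1).E) →* Tr)
    (normT : ℝ → Tr → ℝ) (normT_nonneg : ∀ ρ t, 0 ≤ normT ρ t) (qRoot : I → ℝ) (qRoot_pos : ∀ w ∈ Vss, 0 < qRoot w) :
    letI := fun w => T.algebraBE (ℰ w).E
    Summit.ABC.IUTFork.Joshi.ATS3.PrimeBundlingDatum.FactorsFiniteOverBp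
      (ofPeriodRings ℰ h Vp Vss hV nrm nrm_nonneg locusBE tprod normT normT_nonneg qRoot qRoot_pos) := by
  letI := fun w => T.algebraBE (ℰ w).E
  exact factorsFiniteOverBp_periodRings ℰ _

end PrimeBundlingDatum

end Summit.ABC.IUTFork.Joshi.ATS3

end
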